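import Summits.KontsevichZagierPeriods.KontsevichZagierPeriods.Theses.FurushoPentagon
import Literature.NumberTheory.Transcendental.KZCubicalCalculus
import Literature.NumberTheory.Transcendental.AyoubPeriodSeries
import Literature.NumberTheory.Transcendental.AyoubPeriodSeriesPiAlgebraic
import Literature.NumberTheory.Transcendental.AyoubPeriodSeriesKernel
import Mathlib.RingTheory.MvPowerSeries.Rename
import Mathlib.Algebra.MvPolynomial.Variables

/-!
# `SectorToKernel`, line `effective-cube-surjection`: algebraicity transfer (helper A)

Helper `rsf_algTransfer` for the lead's assembly of `stub_realStokesForm` of the crux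
`FurushoPentagon.SectorToKernel` (stmt-KontsevichZagierPeriods-10813).

Ayoub's ring `𝒪_{ℚ-alg}(𝔻̄^∞)` lives in `ℂ[[z₀, z₁, …]]` (`CSeries = MvPowerSeries ℕ ℂ`) with formal
algebraicity over `ℚ[z₀, z₁, …]` along `polyToCSeries (Rat.castHom ℂ)`, while the KZ side works with
a real series `R : ℝ⟦z₀, …, z_{D-1}⟧`. If `R` complexifies to the restriction
`MvPowerSeries.killCompl Fin.valEmbedding G'` of `G'` to the first `D` variables, and `G'` satisfies a
non-zero polynomial relation `P'(G') = 0` over `ℚ[z]` whose coefficients only involve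
`z₀, …, z_{D-1}`, then `R` satisfies the non-zero relation `P''(R) = 0` with `P''` the image of `P'`
under the truncation `MvPolynomial.killCompl : ℚ[z₀, z₁, …] → ℚ[z₀, …, z_{D-1}]`.

Proof: the ring-hom square "restrict ∘ polyToCSeries = complexify ∘ realify ∘ truncate"
(`rsf_algTransfer_ringHom_comp`, checked on `C q` and `X l` by `MvPolynomial.ringHom_ext`), then
`Polynomial.hom_eval₂` / `Polynomial.eval₂_map` and injectivity of the complexification
`MvPowerSeries.map (algebraMap ℝ ℂ)`; non-vanishing of `P''` because the truncation is a left inverse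
of `rename Fin.val` and every coefficient of `P'` is in the image of `rename Fin.val`
(`MvPolynomial.exists_rename_eq_of_vars_subset_range`). [folklore]
-/

noncomputable section

namespace Summit.KontsevichZagierPeriods.FurushoPentagon.SectorToKernel

open Set MeasureTheory
open Literature.NumberTheory.Transcendental
open Literature.NumberTheory.Transcendental.KZ hiding cubicalSpan
open Summit.KontsevichZagierPeriods.KontsevichZagierPeriods.Theses.FurushoPentagon
open AyoubRel (CSeries Oan intC relAC pdz restrC kSpan DependsOnlyOnLT HasPolyradiusGtOne
  IsAlgebraicOverRatFunc)

/-- The ring-hom square behind the algebraicity transfer: restricting `polyToCSeries (Rat.castHom ℂ)`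
to the variables `z₀, …, z_{D-1}` (`MvPowerSeries.killCompl Fin.valEmbedding`) is the
complexification of the real power series of the truncated polynomial
(`MvPolynomial.killCompl Fin.val_injective`). [folklore] -/
theorem rsf_algTransfer_ringHom_comp (D : ℕ) :
    ((MvPowerSeries.killCompl (R := ℂ) (Fin.valEmbedding : Fin D ↪ ℕ)) :
        CSeries →+* MvPowerSeries (Fin D) ℂ).comp (AyoubRel.polyToCSeries (Rat.castHom ℂ)) =
      (MvPowerSeries.map (σ := Fin D) (algebraMap ℝ ℂ)).comp
        (((MvPolynomial.coeToMvPowerSeries.ringHom (σ := Fin D) (R := ℝ)).comp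
            (MvPolynomial.map (algebraMap ℚ ℝ))).comp
          ((MvPolynomial.killCompl (σ := Fin D) (τ := ℕ) (R := ℚ) (f := Fin.val)
              Fin.val_injective) : MvPolynomial ℕ ℚ →+* MvPolynomial (Fin D) ℚ)) := by
  refine MvPolynomial.ringHom_ext (fun q => ?_) (fun l => ?_)
  · simp only [RingHom.coe_comp, RingHom.coe_coe, Function.comp_apply, AyoubRel.polyToCSeries,
      MvPolynomial.map_C, MvPolynomial.coeToMvPowerSeries.ringHom_apply, MvPolynomial.coe_C,
      MvPowerSeries.killCompl_C, MvPolynomial.killCompl_C, MvPowerSeries.map_C]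
    rw [eq_ratCast (Rat.castHom ℂ), eq_ratCast (algebraMap ℚ ℝ), map_ratCast (algebraMap ℝ ℂ)]
  · simp only [RingHom.coe_comp, RingHom.coe_coe, Function.comp_apply, AyoubRel.polyToCSeries,
      MvPolynomial.map_X, MvPolynomial.coeToMvPowerSeries.ringHom_apply, MvPolynomial.coe_X]
    by_cases h : l ∈ Set.range (Fin.val : Fin D → ℕ)
    · obtain ⟨j, rfl⟩ := h
      have h1 : (MvPowerSeries.X (j : ℕ) : CSeries) =
          MvPowerSeries.X ((Fin.valEmbedding : Fin D ↪ ℕ) j) := rfl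
      have h2 : (MvPolynomial.X (j : ℕ) : MvPolynomial ℕ ℚ) =
          MvPolynomial.rename (Fin.val : Fin D → ℕ) (MvPolynomial.X j) := by
        rw [MvPolynomial.rename_X]
      rw [h1, MvPowerSeries.killCompl_X, h2, MvPolynomial.killCompl_rename_app,
        MvPolynomial.map_X, MvPolynomial.coe_X, MvPowerSeries.map_X]
    · have h' : l ∉ Set.range (Fin.valEmbedding : Fin D ↪ ℕ) := fun ⟨j, hj⟩ => h ⟨j, hj⟩
      have h3 : (MvPolynomial.killCompl (σ := Fin D) (τ := ℕ) (R := ℚ) (f := Fin.val)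
          Fin.val_injective) (MvPolynomial.X l) = 0 := by
        simp only [MvPolynomial.killCompl, MvPolynomial.aeval_X]
        exact dif_neg h
      rw [MvPowerSeries.killCompl_X_eq_zero h', h3, map_zero, MvPolynomial.coe_zero, map_zero]

/-- The complexification `ℝ⟦z₀, …, z_{D-1}⟧ → ℂ⟦z₀, …, z_{D-1}⟧` is injective. [folklore] -/
theorem rsf_algTransfer_map_injective (D : ℕ) :
    Function.Injective (MvPowerSeries.map (σ := Fin D) (algebraMap ℝ ℂ)) := by
  intro a b hab
  ext n
  have h := congrArg (MvPowerSeries.coeff n) hab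
  simp only [MvPowerSeries.coeff_map] at h
  exact (algebraMap ℝ ℂ).injective h

/-- **Helper A (algebraicity transfer to finitely many real variables).** If the real series `R` in
the variables `z₀, …, z_{D-1}` complexifies to the restriction `killCompl` of `G'`, and `G'`
satisfies a non-zero polynomial relation over `ℚ[z]` whose coefficients only involve
`z₀, …, z_{D-1}`, then `R` satisfies a non-zero formal polynomial relation over
`ℚ[z₀, …, z_{D-1}]`. [folklore] -/
theorem rsf_algTransfer : ∀ (D : ℕ) (G' : CSeries) (R : MvPowerSeries (Fin D) ℝ) (P' : Polynomial (MvPolynomial ℕ ℚ)), MvPowerSeries.map (algebraMap ℝ ℂ) R = MvPowerSeries.killCompl (Fin.valEmbedding : Fin D ↪ ℕ) G' → P' ≠ 0 → (∀ k : ℕ, (↑(P'.coeff k).vars : Set ℕ) ⊆ {l : ℕ | l < D}) → Polynomial.eval₂ (AyoubRel.polyToCSeries (Rat.castHom ℂ)) G' P' = 0 → ∃ P'' : Polynomial (MvPolynomial (Fin D) ℚ), P'' ≠ 0 ∧ Polynomial.eval₂ ((MvPolynomial.coeToMvPowerSeries.ringHom (σ := Fin D) (R := ℝ)).comp (MvPolynomial.map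 (algebraMap ℚ ℝ))) R P'' = 0 := by
  intro D G' R P' hR hP' hvars heval
  refine ⟨P'.map ((MvPolynomial.killCompl (σ := Fin D) (τ := ℕ) (R := ℚ) (f := Fin.val)
      Fin.val_injective) : MvPolynomial ℕ ℚ →+* MvPolynomial (Fin D) ℚ), ?_, ?_⟩
  · -- `P'' ≠ 0`: some coefficient of `P'` is non-zero, and it is `rename Fin.val q` with `q ≠ 0`.
    obtain ⟨k, hk⟩ : ∃ k, P'.coeff k ≠ 0 := by
      by_contra h
      exact hP' (Polynomial.ext fun k => by rw [not_exists_not.mp h k, Polynomial.coeff_zero])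
    have hrange : (↑(P'.coeff k).vars : Set ℕ) ⊆ Set.range (Fin.val : Fin D → ℕ) := by
      intro l hl
      exact ⟨⟨l, hvars k hl⟩, rfl⟩
    obtain ⟨q, hq⟩ := MvPolynomial.exists_rename_eq_of_vars_subset_range (P'.coeff k)
      (Fin.val : Fin D → ℕ) Fin.val_injective hrange
    intro h0
    have h1 := congrArg (fun P => Polynomial.coeff P k) h0
    simp only [Polynomial.coeff_map, Polynomial.coeff_zero, RingHom.coe_coe, ← hq,
      MvPolynomial.killCompl_rename_app] at h1
    apply hk
    rw [← hq, h1, map_zero]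
  · -- `P''(R) = 0`: restrict `P'(G') = 0` to the first `D` variables and descend to `ℝ`.
    have key := congrArg ((MvPowerSeries.killCompl (R := ℂ) (Fin.valEmbedding : Fin D ↪ ℕ)) :
      CSeries →+* MvPowerSeries (Fin D) ℂ) heval
    rw [map_zero, Polynomial.hom_eval₂, rsf_algTransfer_ringHom_comp, RingHom.coe_coe, ← hR,
      ← RingHom.comp_assoc, ← Polynomial.eval₂_map, ← Polynomial.hom_eval₂] at key
    exact rsf_algTransfer_map_injective D (key.trans (map_zero _).symm)

end Summit.KontsevichZagierPeriods.FurushoPentagon.SectorToKernel
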